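import Literature.AlgebraicGeometry.Motives.AffineAlgebraicDeRham
import Mathlib.Algebra.MonoidAlgebra.MapDomain
import Mathlib.LinearAlgebra.Basis.VectorSpace
import HarnessLib

/-!
# Descent of exactness of regular forms along a field extension

Sequel to `Literature.AlgebraicGeometry.Motives.AffineAlgebraicDeRham` (definition request
`defn-AffineAlgebraicDeRham` of route `KontsevichZagierPeriods/LinkTwistWrithe`): the requester
needs polynomial primitives *with coefficients in the small field* — for `X ⊆ 𝔸ⁿ_ℚ` cut out by an
ideal `I ⊆ ℚ[x₁, …, xₙ]` and a `ℚ`-form `ω` closed on `X`, Grothendieck's theorem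
(`AffineAlgebraicDeRham`, over `ℂ`) gives a primitive `η` with **complex** coefficients on
`X_ℂ = V(I ℂ[x])`; this file shows that then a primitive with coefficients in `ℚ` (in general: in
the base field `k` of an extension `k ⊆ K`) exists as well.

The argument is the standard faithfully-flat / linear-algebra descent, made explicit:
`Ω^•_{P_K} = Ω^•_{P_k} ⊗_k K`, `d` and the forms vanishing on `X` commute with base change, and a
`k`-linear retraction `r : K → k` of the inclusion (which exists for fields), applied to the
coefficients of a `K`-primitive, yields a `k`-primitive. Concretely:

* `AffineDeRham.coeffwise r` — apply a `k`-linear map `r : K → k` to the coefficients of a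
  polynomial (`AddMonoidAlgebra.map`); it commutes with `∂/∂xᵢ` and with the directional
  derivatives `∂_v`, is `k[x]`-semilinear (`coeffwise r (g f) = g · coeffwise r f` for `g ∈ k[x]`),
  and inverts the base change when `r` is a retraction;
* `AffineDeRham.PolyForm.coeffwise r` — the same on forms (post-composition; the arguments of a
  form are integer vector fields and do not change), commuting with `extDeriv`;
* `AffineDeRham.traceStable I p` — the `K[x]`-submodule of `K`-forms all of whose coefficient
  traces `PolyForm.coeffwise r ω`, `r : K →ₗ[k] k` arbitrary, vanish on `X` over `k`; it contains
  `I K[x] · Ω^•` and is stable under `d`, hence contains `vanishingForms (I.map _)` by the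
  minimality of the latter (`vanishingForms_map_le_traceStable`);
* `AffineDeRham.isExactOn_of_isExactOn_map` / `isExactOn_map_iff` (and the `IsClosedOn`
  versions) — **descent**: for fields `k ⊆ K`, a `k`-form is exact (resp. closed) on `X` over `k`
  iff its base change is exact (resp. closed) on `X_K` over `K`;
* `AffineAlgebraicDeRham.isExactOn_of_subsingleton_of_algebra` — the requester's statement: for a
  subfield `k ⊆ ℂ` (any `[Field k] [Algebra k ℂ]`), `I ⊆ k[x₁, …, xₙ]` with `X_ℂ = V(I ℂ[x])`
  smooth and `H^p(X(ℂ); ℂ) = 0`, every polynomial `p`-form with coefficients in `k` that is closed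
  on `X` has, on `X`, a polynomial primitive WITH COEFFICIENTS IN `k` (under the named fact
  `AffineAlgebraicDeRham`, Grothendieck 1966, Thm 1).

## References

* [Grothendieck1966] A. Grothendieck, *On the de Rham cohomology of algebraic varieties*,
  Publ. Math. IHÉS 29 (1966), Thm 1; footnote 13 for base fields other than `ℂ`.
* [Hartshorne1975] R. Hartshorne, *On the de Rham cohomology of algebraic varieties*,
  Publ. Math. IHÉS 45 (1975), Ch. IV Thm 1.1.
* N. Bourbaki, *Algèbre commutative* I §3 (faithfully flat descent of linear equations) — here
  replaced by an explicit retraction, N. Bourbaki, *Algèbre* II §7 no. 9.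
-/

noncomputable section

open MvPolynomial

namespace Literature.AlgebraicGeometry.Motives

namespace AffineDeRham

section General

variable {k K : Type*} [CommRing k] [CommRing K] [Algebra k K] {n : ℕ}

/-! ### Coefficientwise linear maps on polynomials -/

/-- Apply a `k`-linear map `r : K → k` to every coefficient of a polynomial over `K`
(`AddMonoidAlgebra.map`), a `k`-linear map `K[x₁, …, xₙ] → k[x₁, …, xₙ]`; for a retraction `r`
of `k ⊆ K` this is a `k[x]`-linear "trace" inverting the base change. [folklore] -/
def coeffwise (r : K →ₗ[k] k) : MvPolynomial (Fin n) K →ₗ[k] MvPolynomial (Fin n) k where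
  toFun f := AddMonoidAlgebra.map r.toAddMonoidHom f
  map_add' := AddMonoidAlgebra.map_add _
  map_smul' c f := MvPolynomial.ext _ _ fun m => by
    simp [MvPolynomial.coeff_addMonoidAlgebraMap]

/-- The coefficients of `coeffwise r f` are the images of those of `f`. [folklore] -/
@[simp]
theorem coeff_coeffwise (r : K →ₗ[k] k) (m : Fin n →₀ ℕ) (f : MvPolynomial (Fin n) K) :
    MvPolynomial.coeff m (coeffwise r f) = r (MvPolynomial.coeff m f) :=
  rfl

/-- Coefficientwise maps commute with the partial derivatives `∂/∂xᵢ` (whose effect on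
coefficients is multiplication by natural numbers). [folklore] -/
theorem coeffwise_pderiv (r : K →ₗ[k] k) (i : Fin n) (f : MvPolynomial (Fin n) K) :
    coeffwise r (pderiv i f) = pderiv i (coeffwise r f) := by
  refine MvPolynomial.ext _ _ fun m => ?_
  rw [coeff_coeffwise, coeff_pderiv, coeff_pderiv, coeff_coeffwise]
  have key : ∀ c : K, r (c * ((m i : K) + 1)) = r c * ((m i : k) + 1) := fun c => by
    rw [show c * ((m i : K) + 1) = (m i + 1) • c by rw [nsmul_eq_mul, Nat.cast_succ, mul_comm],
      map_nsmul, nsmul_eq_mul, Nat.cast_succ, mul_comm]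
  exact key _

/-- Coefficientwise maps commute with the directional derivatives along integer vector fields.
[folklore] -/
theorem coeffwise_dirDeriv (r : K →ₗ[k] k) (v : Fin n → ℤ) (f : MvPolynomial (Fin n) K) :
    coeffwise r (dirDeriv v f) = dirDeriv v (coeffwise r f) := by
  rw [dirDeriv_apply, dirDeriv_apply, map_sum]
  refine Finset.sum_congr rfl fun i _ => ?_
  rw [Int.cast_smul_eq_zsmul, Int.cast_smul_eq_zsmul, map_zsmul, coeffwise_pderiv]

/-- `k[x]`-semilinearity: `coeffwise r (g f) = g · coeffwise r f` for `g` with coefficients in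
`k`. [folklore] -/
theorem coeffwise_map_mul (r : K →ₗ[k] k) (g : MvPolynomial (Fin n) k)
    (f : MvPolynomial (Fin n) K) :
    coeffwise r (MvPolynomial.map (algebraMap k K) g * f) = g * coeffwise r f := by
  classical
  refine MvPolynomial.ext _ _ fun m => ?_
  rw [coeff_coeffwise, coeff_mul, coeff_mul, map_sum]
  refine Finset.sum_congr rfl fun x _ => ?_
  rw [coeff_map, coeff_coeffwise, ← Algebra.smul_def, map_smul, smul_eq_mul]

/-- Multiplication by a monomial with coefficient `a ∈ K` is traced to multiplication by the
monomial, the coefficient map being twisted by `a`: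
`coeffwise r (a x^α · f) = x^α · coeffwise (r ∘ (a·)) f`. [folklore] -/
theorem coeffwise_monomial_mul (r : K →ₗ[k] k) (α : Fin n →₀ ℕ) (a : K)
    (f : MvPolynomial (Fin n) K) :
    coeffwise r (monomial α a * f) =
      monomial α 1 * coeffwise (r ∘ₗ LinearMap.mulLeft k a) f := by
  refine MvPolynomial.ext _ _ fun m => ?_
  rw [coeff_coeffwise, coeff_monomial_mul', coeff_monomial_mul']
  split_ifs with h
  · rw [one_mul, coeff_coeffwise, LinearMap.comp_apply, LinearMap.mulLeft_apply]
  · rw [map_zero]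

/-- A retraction of `k → K` applied coefficientwise inverts the base change of polynomials.
[folklore] -/
theorem coeffwise_map {r : K →ₗ[k] k} (hr : ∀ x, r (algebraMap k K x) = x)
    (g : MvPolynomial (Fin n) k) : coeffwise r (MvPolynomial.map (algebraMap k K) g) = g :=
  MvPolynomial.ext _ _ fun m => by rw [coeff_coeffwise, coeff_map, hr]

/-! ### The coefficient trace on forms -/

/-- `(−1)ⁱ x = (−1)ⁱ • x` with the sign read in `ℤ` (to move signs through additive maps).
[folklore] -/
theorem neg_one_pow_mul_eq_zsmul {R : Type*} [Ring R] (i : ℕ) (x : R) :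
    (-1 : R) ^ i * x = ((-1 : ℤ) ^ i) • x := by
  rw [zsmul_eq_mul, Int.cast_pow, Int.cast_neg, Int.cast_one]

variable (n) in
/-- Apply a `k`-linear map `r : K → k` to the coefficients of a polynomial form over `K`
(the arguments — integer vector fields — are unchanged): `(T_r ω)(v) = coeffwise r (ω(v))`.
[folklore] -/
def PolyForm.coeffwise (r : K →ₗ[k] k) (p : ℕ) : PolyForm K n p →ₗ[k] PolyForm k n p where
  toFun ω := ((AffineDeRham.coeffwise r : MvPolynomial (Fin n) K →ₗ[k] MvPolynomial (Fin n) k)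
    |>.toAddMonoidHom.toIntLinearMap).compAlternatingMap ω
  map_add' _ _ := AlternatingMap.ext fun _ => by simp
  map_smul' _ _ := AlternatingMap.ext fun _ => by simp

/-- `(T_r ω)(v) = coeffwise r (ω v)`. [folklore] -/
@[simp]
theorem PolyForm.coeffwise_apply (r : K →ₗ[k] k) {p : ℕ} (ω : PolyForm K n p)
    (v : Fin p → Fin n → ℤ) :
    PolyForm.coeffwise n r p ω v = AffineDeRham.coeffwise r (ω v) :=
  rfl

/-- The trace inverts the base change of forms when `r` is a retraction. [folklore] -/
theorem PolyForm.coeffwise_map {r : K →ₗ[k] k} (hr : ∀ x, r (algebraMap k K x) = x) {p : ℕ}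
    (ω : PolyForm k n p) :
    PolyForm.coeffwise n r p (PolyForm.map n p (algebraMap k K) ω) = ω :=
  AlternatingMap.ext fun v => by simp [AffineDeRham.coeffwise_map hr]

/-- The trace commutes with the exterior derivative: `T_r (dω) = d (T_r ω)`. [folklore] -/
theorem PolyForm.coeffwise_extDeriv (r : K →ₗ[k] k) {p : ℕ} (ω : PolyForm K n p) :
    PolyForm.coeffwise n r (p + 1) (extDeriv ω) = extDeriv (PolyForm.coeffwise n r p ω) := by
  refine AlternatingMap.ext fun v => ?_
  rw [PolyForm.coeffwise_apply, extDeriv_apply, extDeriv_apply, map_sum]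
  refine Finset.sum_congr rfl fun i _ => ?_
  rw [neg_one_pow_mul_eq_zsmul, neg_one_pow_mul_eq_zsmul, map_zsmul, coeffwise_dirDeriv,
    PolyForm.coeffwise_apply]

/-- The trace is `k[x]`-semilinear on forms: `T_r ((ι g) ω) = g · T_r ω`. [folklore] -/
theorem PolyForm.coeffwise_map_smul (r : K →ₗ[k] k) {p : ℕ} (g : MvPolynomial (Fin n) k)
    (ω : PolyForm K n p) :
    PolyForm.coeffwise n r p (MvPolynomial.map (algebraMap k K) g • ω) =
      g • PolyForm.coeffwise n r p ω :=
  AlternatingMap.ext fun v => by simp [coeffwise_map_mul]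

/-- Twisting rule for multiplication by a monomial with coefficient in `K`. [folklore] -/
theorem PolyForm.coeffwise_monomial_smul (r : K →ₗ[k] k) {p : ℕ} (α : Fin n →₀ ℕ) (a : K)
    (ω : PolyForm K n p) :
    PolyForm.coeffwise n r p (monomial α a • ω) =
      monomial α (1 : k) • PolyForm.coeffwise n (r ∘ₗ LinearMap.mulLeft k a) p ω :=
  AlternatingMap.ext fun v => by simp [coeffwise_monomial_mul]

/-! ### Descent -/

variable (I : Ideal (MvPolynomial (Fin n) k))

variable (K n) in
/-- The `K`-forms all of whose coefficient traces vanish on `X` over `k`: a `K[x]`-submodule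
(closure under `K[x]`-multiples follows from the twisting rule on monomials). [folklore] -/
def traceStable (p : ℕ) : Submodule (MvPolynomial (Fin n) K) (PolyForm K n p) where
  carrier := {ω | ∀ r : K →ₗ[k] k, PolyForm.coeffwise n r p ω ∈ vanishingForms I p}
  zero_mem' r := by rw [map_zero]; exact Submodule.zero_mem _
  add_mem' ha hb r := by rw [map_add]; exact Submodule.add_mem _ (ha r) (hb r)
  smul_mem' c ω hω r := by
    induction c using MvPolynomial.induction_on' with
    | monomial α a =>
      rw [PolyForm.coeffwise_monomial_smul]
      exact Submodule.smul_mem _ _ (hω _)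
    | add c₁ c₂ h₁ h₂ =>
      rw [add_smul, map_add]
      exact Submodule.add_mem _ h₁ h₂

/-- Membership in `traceStable`. [folklore] -/
theorem mem_traceStable_iff {p : ℕ} (ω : PolyForm K n p) :
    ω ∈ traceStable K n I p ↔
      ∀ r : K →ₗ[k] k, PolyForm.coeffwise n r p ω ∈ vanishingForms I p :=
  Iff.rfl

/-- **Traces of forms vanishing on `X_K` vanish on `X`**: the forms vanishing on the base change
`V(I K[x])` lie in `traceStable` (minimality of `vanishingForms`: `traceStable` contains
`I K[x] · Ω^•` by `k[x]`-semilinearity of the trace and is stable under `d`). [folklore] -/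
theorem vanishingForms_map_le_traceStable (p : ℕ) :
    vanishingForms (I.map (MvPolynomial.map (algebraMap k K))) p ≤ traceStable K n I p := by
  refine vanishingForms_le _ (N := traceStable K n I) (fun q => ?_) (fun q ω hω r => ?_) p
  · refine Submodule.smul_le.mpr fun c hc ω _ => ?_
    refine Submodule.span_induction (p := fun c _ => ∀ ω : PolyForm K n q, c • ω ∈ traceStable K n I q)
      ?_ ?_ ?_ ?_ hc ω
    · rintro _ ⟨g, hg, rfl⟩ ω r
      rw [PolyForm.coeffwise_map_smul]
      exact smul_mem_vanishingForms I hg _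
    · intro ω; rw [zero_smul]; exact Submodule.zero_mem _
    · intro c₁ c₂ _ _ h₁ h₂ ω; rw [add_smul]; exact Submodule.add_mem _ (h₁ ω) (h₂ ω)
    · intro a c _ hc ω; rw [smul_eq_mul, mul_smul]; exact Submodule.smul_mem _ a (hc ω)
  · rw [PolyForm.coeffwise_extDeriv]
    exact extDeriv_mem_vanishingForms I (hω r)

/-- **Descent of closedness** along a retraction: if the base change of `ω` is closed on `X_K`
then `ω` is closed on `X` (given a `k`-linear retraction `r` of `k → K`). [folklore] -/
theorem isClosedOn_of_isClosedOn_map {r : K →ₗ[k] k} (hr : ∀ x, r (algebraMap k K x) = x)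
    {p : ℕ} {ω : PolyForm k n p}
    (h : IsClosedOn (I.map (MvPolynomial.map (algebraMap k K))) (PolyForm.map n p (algebraMap k K) ω)) :
    IsClosedOn I ω := by
  have := vanishingForms_map_le_traceStable I (p + 1) h r
  rw [PolyForm.coeffwise_extDeriv, PolyForm.coeffwise_map hr] at this
  exact this

/-- **Descent of exactness** along a retraction: if the base change of `ω` is exact on `X_K`,
with a primitive `η` having coefficients in `K`, then `ω` is exact on `X` over `k` — the trace
`T_r η` of the primitive is a primitive with coefficients in `k`. [folklore] -/
theorem isExactOn_of_isExactOn_map {r : K →ₗ[k] k} (hr : ∀ x, r (algebraMap k K x) = x) :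
    ∀ {p : ℕ} {ω : PolyForm k n p},
      IsExactOn (I.map (MvPolynomial.map (algebraMap k K))) (PolyForm.map n p (algebraMap k K) ω) →
        IsExactOn I ω
  | 0, ω, h => by
    have := vanishingForms_map_le_traceStable I 0 h r
    rw [PolyForm.coeffwise_map hr] at this
    exact this
  | p + 1, ω, ⟨η, hη⟩ => ⟨PolyForm.coeffwise n r p η, by
    have := vanishingForms_map_le_traceStable I (p + 1) hη r
    rw [map_sub, PolyForm.coeffwise_map hr, PolyForm.coeffwise_extDeriv] at this
    exact this⟩

end General

section Fields

variable {k K : Type*} [Field k] [Field K] [Algebra k K] {n : ℕ}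
  (I : Ideal (MvPolynomial (Fin n) k))

/-- A field extension admits a `k`-linear retraction `K → k`. [folklore] -/
theorem exists_retraction : ∃ r : K →ₗ[k] k, ∀ x, r (algebraMap k K x) = x := by
  obtain ⟨r, hr⟩ := (Algebra.linearMap k K).exists_leftInverse_of_injective
    (LinearMap.ker_eq_bot.mpr (algebraMap k K).injective)
  exact ⟨r, fun x => LinearMap.congr_fun hr x⟩

/-- **Closedness descends along field extensions** (and ascends: `IsClosedOn.map`). [folklore] -/
theorem isClosedOn_map_iff {p : ℕ} (ω : PolyForm k n p) :
    IsClosedOn (I.map (MvPolynomial.map (algebraMap k K))) (PolyForm.map n p (algebraMap k K) ω) ↔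
      IsClosedOn I ω := by
  obtain ⟨r, hr⟩ := exists_retraction (k := k) (K := K)
  exact ⟨isClosedOn_of_isClosedOn_map I hr, IsClosedOn.map I _⟩

/-- **Exactness descends along field extensions**: a polynomial form with coefficients in `k`
has a polynomial primitive on `X = V(I)` with coefficients in `k` as soon as it has one with
coefficients in the extension field `K` on `X_K = V(I K[x])` (and conversely). [folklore] -/
theorem isExactOn_map_iff {p : ℕ} (ω : PolyForm k n p) :
    IsExactOn (I.map (MvPolynomial.map (algebraMap k K))) (PolyForm.map n p (algebraMap k K) ω) ↔
      IsExactOn I ω := by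
  obtain ⟨r, hr⟩ := exists_retraction (k := k) (K := K)
  exact ⟨isExactOn_of_isExactOn_map I hr, IsExactOn.map I _⟩

end Fields

end AffineDeRham

/-! ### The requester's statement: polynomial primitives over the field of definition -/

namespace AffineAlgebraicDeRham

open AffineDeRham Literature.AlgebraicTopology.SingularHomology

/-- **Polynomial primitives over the field of definition.** Under Grothendieck's theorem
(`AffineAlgebraicDeRham`): let `k` be a subfield of `ℂ` (`[Field k] [Algebra k ℂ]`),
`I ⊆ k[x₁, …, xₙ]`, and assume the complexification `X_ℂ = Spec (ℂ[x]/I ℂ[x])` is smooth with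
`H^p(X(ℂ); ℂ) = 0`. Then every polynomial `p`-form with coefficients in `k` that is closed on `X`
is exact on `X` over `k`: in positive degree `ω − dη` vanishes on `X` for a polynomial form `η`
WITH COEFFICIENTS IN `k` (first instances: `k = ℚ`, the quadrics `Σ xᵢ² = 1` in `𝔸³`, `𝔸⁴`, in
the degrees where the Betti cohomology of the complex quadric vanishes). [cite: Grothendieck1966, Thm 1] -/
theorem isExactOn_of_subsingleton_of_algebra (h : AffineAlgebraicDeRham) {k : Type*} [Field k]
    [Algebra k ℂ] {n : ℕ} {I : Ideal (MvPolynomial (Fin n) k)}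
    [Algebra.Smooth ℂ (MvPolynomial (Fin n) ℂ ⧸ I.map (MvPolynomial.map (algebraMap k ℂ)))]
    {p : ℕ} [Subsingleton (singularCohomology ℂ ℂ
      (MvPolynomial.zeroLocus ℂ (I.map (MvPolynomial.map (algebraMap k ℂ)))) p)]
    {ω : PolyForm k n p} (hω : IsClosedOn I ω) : IsExactOn I ω :=
  (isExactOn_map_iff I ω).mp (isExactOn_of_subsingleton h (hω.map I (algebraMap k ℂ)))

end AffineAlgebraicDeRham

end Literature.AlgebraicGeometry.Motives

end
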